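import Summits.CriticalPhenomena.CardyFormulaZ2.Theorems.CardyComplexConeParafermionToSLESixFamiliesDiamondTracePos
import HarnessLib

/-!
# The boundary direction `τ` of a marked diamond and its Schwarz–Christoffel turning rule
# (line `potential-darboux-picard-diamond`, S1′ clause (TURN))

Crux `ParafermionToSLESixFamilies` (stmt-CriticalPhenomena-11389), line `potential-darboux-picard-diamond`,
stub `stub_exactPotentialTracePh` (S1′). Its clauses (τ-NORM) and (TURN) concern the direction function
`τ : ℂ → ℂ → ℂ` alone:
`‖τ p q‖ = 1` on oriented boundary segments, and for consecutive segments `p → v → q`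
`τ(v,q) = τ(p,v) · exp(i (⅔·arg((q-v)/(v-p)) + π/3·markInd D v))`.
On a marked diamond all six turns — the four corners (`⅔ · π/2`) and the two marks (`π/3`) — are by
`+π/3`, total `2π`. This file DEFINES `τ` explicitly and PROVES both clauses:

* `dSideIx u` — the side index `0,1,2,3` of a counter-clockwise side direction `u ∈ ℝ₊·{1, i, -1, -i}`
  in the frame; `dMarkCount` — the number of marks met on the counter-clockwise boundary from the cut
  corner `(-α,-β)` up to and including a point (positions `dPos`, `…DiamondTracePos.lean`);
* `diamondTau c α β m₀ m₁ p q = exp(iπ/3 · (dSideIx (q' - p') + dMarkCount (p')))` (primes: frame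
  coordinates `dRot c`) — unimodular by construction (`norm_diamondTau`);
* `diamondTau_turn` — **(TURN)** for a Dobrushin domain whose carrier is the open rotated rectangle: by
  `segData_of_isBdrySegment` both segments are side pieces; either they are collinear (`arg = 0`, the mark
  count steps by `[v is a mark]`, `markStep`), or `v` is the next corner (`arg = π/2`, side index `+1`,
  `markStep`), or `v` is the cut corner (side index `3 → 0`, mark count `2 → [v is a mark]`,
  `markStep_cut`; the exponents differ by `2π`);
* `exists_tau_of_isMarkedDiamond` (registered, `--supports` the crux) — for every marked diamond there is
  a `τ` satisfying (τ-NORM) and (TURN) verbatim as in `ExactPotentialTracePh`.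

Elementary; nothing cited (the rule is the boundary behaviour of `∫(φ′)^{1/3}`, Duminil-Copin–Smirnov,
arXiv:1109.1549, §8, but no analysis enters here).
-/

noncomputable section

namespace Summit.CriticalPhenomena.CardyFormulaZ2.Cruxes.ParafermionToSLESixFamilies.PotentialDarbouxPicardDiamond

open Set Metric Complex
open Literature.Probability.RandomPlanarGeometry

variable {α β : ℝ}

/-! ## Frame invariance of the turning quotient and of open segments -/

/-- **The turning quotient is frame invariant**: `(q - v)/(v - p)` is unchanged under `dRot c`. -/
theorem turnQuot_dRot (c p v q : ℂ) :
    (dRot c q - dRot c v) / (dRot c v - dRot c p) = (q - v) / (v - p) := by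
  rw [dRot_sub, dRot_sub]
  rcases eq_or_ne (v - p) 0 with h | h
  · rw [h, zero_mul, div_zero, div_zero]
  · rw [mul_div_mul_right _ _ (Complex.exp_ne_zero _)]

/-- The frame map sends open segments to open segments. -/
theorem dRot_mem_openSegment_iff (c m p v : ℂ) :
    dRot c m ∈ openSegment ℝ (dRot c p) (dRot c v) ↔ m ∈ openSegment ℝ p v := by
  rw [openSegment_eq_image', openSegment_eq_image', mem_image, mem_image]
  constructor
  · rintro ⟨t, ht, h⟩
    refine ⟨t, ht, dRot_injective c ?_⟩
    rw [← h, dRot_sub]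
    unfold dRot
    simp only [real_smul]
    ring
  · rintro ⟨t, ht, rfl⟩
    refine ⟨t, ht, ?_⟩
    rw [dRot_sub]
    unfold dRot
    simp only [real_smul]
    ring

/-- Consecutive directions turn by `+π/2`: `dDir (k + 1) = i · dDir k`. -/
theorem dDir_succ (k : Fin 4) : dDir (k + 1) = I * dDir k := by
  fin_cases k <;> simp [dDir]

/-- Directions are nonzero. -/
theorem dDir_ne_zero (k : Fin 4) : dDir k ≠ 0 := by
  fin_cases k <;> simp [dDir]

/-! ## The direction function -/

/-- The side index of a counter-clockwise side direction in the frame: `0` east, `1` north, `2` west,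
`3` south (junk `3` otherwise). -/
def dSideIx (u : ℂ) : ℕ :=
  if 0 < u.re ∧ u.im = 0 then 0 else if 0 < u.im ∧ u.re = 0 then 1 else if u.re < 0 ∧ u.im = 0 then 2 else 3

/-- The side index of a positive multiple of `dDir k` is `k`. -/
theorem dSideIx_dDir (k : Fin 4) {r : ℝ} (hr : 0 < r) : dSideIx ((r : ℂ) * dDir k) = (k : ℕ) := by
  fin_cases k <;> simp [dSideIx, dDir, hr, hr.ne', not_lt.2 hr.le]

/-- The number of the two marks `M₀, M₁` (frame coordinates) at boundary position at most that of `P`. -/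
def dMarkCount (α β : ℝ) (M₀ M₁ P : ℂ) : ℕ :=
  (if dPos α β M₀ ≤ dPos α β P then 1 else 0) + (if dPos α β M₁ ≤ dPos α β P then 1 else 0)

/-- **The boundary direction of a marked diamond** (centre `c`, half-widths `α, β`, marks `m₀, m₁`):
`τ(p, q) = exp(iπ/3 · (side index of [p,q] + number of marks weakly before p))`, the cut being the
corner `(-α,-β)`. -/
def diamondTau (c : ℂ) (α β : ℝ) (m₀ m₁ : ℂ) (p q : ℂ) : ℂ :=
  exp (((Real.pi / 3 * ((dSideIx (dRot c q - dRot c p) : ℝ) +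
    (dMarkCount α β (dRot c m₀) (dRot c m₁) (dRot c p) : ℝ)) : ℝ) : ℂ) * I)

/-- **(τ-NORM)** `τ` is unimodular. -/
theorem norm_diamondTau (c : ℂ) (α β : ℝ) (m₀ m₁ p q : ℂ) : ‖diamondTau c α β m₀ m₁ p q‖ = 1 :=
  norm_exp_ofReal_mul_I _

/-! ## The turning rule -/

/-- The mark indicator as a count over the two (distinct) marks. -/
theorem markInd_eq (D : DobrushinDomain) (v : ℂ) :
    markInd D v = ((if D.pt 0 = v then 1 else 0) + (if D.pt 1 = v then 1 else 0) : ℕ) := by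
  unfold markInd
  have hne : D.pt 0 ≠ D.pt 1 := fun h => by
    have := D.pt_injective h; exact absurd this (by decide)
  by_cases h0 : D.pt 0 = v
  · rw [if_pos (Or.inl h0.symm), if_pos h0, if_neg (fun h1 => hne (h0.trans h1.symm))]; norm_num
  · by_cases h1 : D.pt 1 = v
    · rw [if_pos (Or.inr h1.symm), if_neg h0, if_pos h1]; norm_num
    · rw [if_neg (by rintro (h | h) <;> [exact h0 h.symm; exact h1 h.symm]), if_neg h0, if_neg h1]; norm_num

/-- Exponentials of real multiples of `i` that differ by `2π` agree. -/
theorem exp_mul_I_eq_of_add_two_pi {x y : ℝ} (h : y = x + 2 * Real.pi) :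
    exp ((y : ℂ) * I) = exp ((x : ℂ) * I) := by
  rw [h]; push_cast
  rw [add_mul, Complex.exp_add, Complex.exp_two_pi_mul_I, mul_one]

variable {D : DobrushinDomain} {c : ℂ}

/-- **(TURN) The Schwarz–Christoffel turning rule of `τ` on a marked diamond.** For a Dobrushin domain
whose carrier is the open rotated rectangle (centre `c`, half-widths `α, β > 0`) and consecutive oriented
boundary segments `p → v → q`:
`τ(v,q) = τ(p,v) · exp(i (⅔·arg((q-v)/(v-p)) + π/3·markInd D v))`. -/
theorem diamondTau_turn (hα : 0 < α) (hβ : 0 < β)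
    (hD : D.carrier = {z | |(dRot c z).re| < α ∧ |(dRot c z).im| < β}) {p v q : ℂ}
    (h1 : IsBdrySegment D p v) (h2 : IsBdrySegment D v q) :
    diamondTau c α β (D.pt 0) (D.pt 1) v q = diamondTau c α β (D.pt 0) (D.pt 1) p v *
      exp (((2 / 3 : ℝ) * ((q - v) / (v - p)).arg + (Real.pi / 3) * markInd D v : ℝ) * I) := by
  -- side data of the two segments
  obtain ⟨k₁, s₁, t₁, hs₁, hst₁, ht₁, hP, hV⟩ := segData_of_isBdrySegment hα hβ hD h1
  obtain ⟨k₂, s₂, t₂, hs₂, hst₂, ht₂, hV', hQ⟩ := segData_of_isBdrySegment hα hβ hD h2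
  -- the marks: boundary points of the frame off the open segment `(P, V)`
  have hmark : ∀ j : Fin 2, ∃ (k' : Fin 4) (m : ℝ), 0 ≤ m ∧ m < dLen α β k' ∧
      dRot c (D.pt j) = dParam α β k' m := by
    intro j
    obtain ⟨hre, him, hnot⟩ := bdry_of_mem_frontier hD (D.pt_mem_frontier j)
    exact exists_dParam_of_bdry hα hre him hnot
  have hoff : ∀ j : Fin 2, dRot c (D.pt j) ∉ openSegment ℝ (dParam α β k₁ s₁) (dParam α β k₁ t₁) := by
    intro j
    rw [← hP, ← hV, dRot_mem_openSegment_iff]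
    obtain ⟨-, -, h0, h1', -⟩ := h1
    fin_cases j
    · exact h0
    · exact h1'
  have hinj : ∀ j : Fin 2, dRot c (D.pt j) = dRot c v ↔ D.pt j = v := fun j =>
    ⟨fun h => dRot_injective c h, fun h => by rw [h]⟩
  -- the turning quotient and the side indices in the frame
  have hquot : (q - v) / (v - p) = (dRot c q - dRot c v) / (dRot c v - dRot c p) := (turnQuot_dRot c p v q).symm
  have hix₁ : dSideIx (dRot c v - dRot c p) = (k₁ : ℕ) := by
    rw [hP, hV, dParam_sub]; exact dSideIx_dDir k₁ (by linarith)
  have hix₂ : dSideIx (dRot c q - dRot c v) = (k₂ : ℕ) := by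
    rw [hV', hQ, dParam_sub]; exact dSideIx_dDir k₂ (by linarith)
  unfold diamondTau dMarkCount
  rw [hix₁, hix₂, markInd_eq, ← Complex.exp_add]
  rcases ht₁.lt_or_eq with ht₁' | ht₁'
  · -- (a) `v` interior to side `k₁`: the segments are collinear
    obtain ⟨hk, hs₂t₁⟩ : k₂ = k₁ ∧ s₂ = t₁ := by
      have := dParam_inj hα hβ hs₂ (lt_of_lt_of_le hst₂ ht₂) (by linarith) ht₁' (hV'.symm.trans hV)
      exact ⟨this.1, this.2⟩
    subst hk hs₂t₁
    have harg : ((q - v) / (v - p)).arg = 0 := by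
      rw [hquot, hP, hV, hQ, dParam_sub, dParam_sub, mul_div_mul_right _ _ (dDir_ne_zero _), ← Complex.ofReal_div]
      exact Complex.arg_ofReal_of_nonneg (div_nonneg (by linarith) (by linarith))
    have hstep : ∀ j : Fin 2, (if dPos α β (dRot c (D.pt j)) ≤ dPos α β (dRot c v) then 1 else 0 : ℕ) =
        (if dPos α β (dRot c (D.pt j)) ≤ dPos α β (dRot c p) then 1 else 0) + (if D.pt j = v then 1 else 0) := by
      intro j
      obtain ⟨k', m, hm, hm', hM⟩ := hmark j
      have hms := markStep hα hβ hs₁ hst₁ ht₁ (fun h => absurd h.2 ht₁'.ne) hm hm' hM (hoff j)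
      rw [hP, hV]
      rw [hV] at hinj
      refine ite_eq_ite_add_ite (hms.1.trans (or_congr Iff.rfl (hinj j))) fun h h' => hms.2 h ((hinj j).2 h')
    rw [harg, hstep 0, hstep 1]
    congr 1
    push_cast
    ring
  · -- `v` is the corner after side `k₁`
    subst ht₁'
    have hVc : dRot c v = dParam α β (k₁ + 1) 0 := by rw [hV, dParam_dLen, dParam_zero]
    obtain ⟨hk, hs₂0⟩ : k₂ = k₁ + 1 ∧ s₂ = 0 := by
      have := dParam_inj hα hβ hs₂ (lt_of_lt_of_le hst₂ ht₂) le_rfl (dLen_pos hα hβ _) (hV'.symm.trans hVc)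
      exact ⟨this.1, this.2⟩
    subst hk hs₂0
    have harg : ((q - v) / (v - p)).arg = Real.pi / 2 := by
      have hq' : (q - v) / (v - p) = ((t₂ - 0) / (dLen α β k₁ - s₁) : ℝ) * I := by
        have hd := dDir_ne_zero k₁
        have hden : ((dLen α β k₁ - s₁ : ℝ) : ℂ) ≠ 0 :=
          Complex.ofReal_ne_zero.2 (by intro h; linarith)
        rw [hquot, hQ, hV', hP, dParam_sub, ← hVc, hV, dParam_sub, dDir_succ, Complex.ofReal_div]
        field_simp
      rw [hq', Complex.arg_real_mul _ (div_pos (by linarith) (by linarith))]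
      exact Complex.arg_I
    rw [harg]
    by_cases hk3 : k₁ = 3
    · -- (c) across the cut corner `(-α,-β)`: side index `3 → 0`, mark count `2 → [v is a mark]`
      subst hk3
      have hstep : ∀ j : Fin 2, (dPos α β (dRot c (D.pt j)) ≤ dPos α β (dRot c p)) ∧
          (dPos α β (dRot c (D.pt j)) ≤ dPos α β (dRot c v) ↔ D.pt j = v) := by
        intro j
        obtain ⟨k', m, hm, hm', hM⟩ := hmark j
        have hms := markStep_cut hα hβ hs₁ hst₁ hm hm' hM (hoff j)
        rw [hP, hV]
        rw [hV] at hinj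
        exact ⟨hms.1, hms.2.trans (hinj j)⟩
      simp only [if_pos (hstep 0).1, if_pos (hstep 1).1]
      rw [show (if dPos α β (dRot c (D.pt 0)) ≤ dPos α β (dRot c v) then 1 else 0 : ℕ) =
          (if D.pt 0 = v then 1 else 0 : ℕ) from by simp only [(hstep 0).2],
        show (if dPos α β (dRot c (D.pt 1)) ≤ dPos α β (dRot c v) then 1 else 0 : ℕ) =
          (if D.pt 1 = v then 1 else 0 : ℕ) from by simp only [(hstep 1).2]]
      rw [← add_mul, ← Complex.ofReal_add]
      refine (exp_mul_I_eq_of_add_two_pi ?_).symm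
      have h30 : (((3 : Fin 4) + 1 : Fin 4) : ℕ) = 0 := rfl
      have h3 : (((3 : Fin 4) : Fin 4) : ℕ) = 3 := rfl
      simp only [h30, h3]
      push_cast
      ring
    · -- (b) an ordinary corner: side index `+1`, mark count steps by `[v is a mark]`
      have hstep : ∀ j : Fin 2, (if dPos α β (dRot c (D.pt j)) ≤ dPos α β (dRot c v) then 1 else 0 : ℕ) =
          (if dPos α β (dRot c (D.pt j)) ≤ dPos α β (dRot c p) then 1 else 0) + (if D.pt j = v then 1 else 0) := by
        intro j
        obtain ⟨k', m, hm, hm', hM⟩ := hmark j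
        have hms := markStep hα hβ hs₁ hst₁ le_rfl (fun h => hk3 h.1) hm hm' hM (hoff j)
        rw [hP, hV]
        rw [hV] at hinj
        refine ite_eq_ite_add_ite (hms.1.trans (or_congr Iff.rfl (hinj j))) fun h h' => hms.2 h ((hinj j).2 h')
      have hval : (((k₁ + 1 : Fin 4) : ℕ) : ℝ) = (k₁ : ℕ) + 1 := by
        fin_cases k₁ <;> simp at hk3 ⊢ <;> norm_num
      rw [hstep 0, hstep 1, hval]
      congr 1
      push_cast
      ring

/-- **(τ-NORM) + (TURN) for marked diamonds, in the shape of `ExactPotentialTracePh`** (registered helper of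
`stub_exactPotentialTracePh`): every marked diamond carries a direction function `τ` on oriented boundary
segments, unimodular, turning by the Schwarz–Christoffel rule of `∫(φ′)^{1/3}` at corners and marks. -/
theorem exists_tau_of_isMarkedDiamond : ∀ (D : DobrushinDomain), IsMarkedDiamond D → ∃ τ : ℂ → ℂ → ℂ, (∀ p q : ℂ, IsBdrySegment D p q → ‖τ p q‖ = 1) ∧ (∀ p v q : ℂ, IsBdrySegment D p v → IsBdrySegment D v q → τ v q = τ p v * exp (((2 / 3 : ℝ) * ((q - v) / (v - p)).arg + (Real.pi / 3) * markInd D v : ℝ) * I)) := by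
  intro D hD
  obtain ⟨c, α, β, hα, hβ, hcar⟩ := hD
  refine ⟨diamondTau c α β (D.pt 0) (D.pt 1), fun p q _ => norm_diamondTau _ _ _ _ _ _ _, fun p v q h1 h2 => ?_⟩
  exact diamondTau_turn hα hβ hcar h1 h2

end Summit.CriticalPhenomena.CardyFormulaZ2.Cruxes.ParafermionToSLESixFamilies.PotentialDarbouxPicardDiamond

end
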